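import Mathlib
import HarnessLib

/-!
# Route ClusUniversalCertificate — path `coord` on the crux `UniversalCertAll` (stmt-PneNP-19683): the objects (mixed block sizes)
(rung F-N1, cell pnp-ideate, planner p1 g6; registered skeleton HOME/pnp-ideate-p1/lines/layer.lean v6 sha16 ed80fa781593c29a, second path
`coord`, card lines/coord.md; stubs `stub_transfer` (M), `stub_inv` (M), `stub_cBook` (M), `stub_slice` (M–L) WANTED for provers on STATUS
08:49Z; `stub_cllZeroRare` is the XL conjecture)

The objects of p1's path `coord` VERBATIM (`acodim`, `dsum`, `bsize`, `zcount`, `wcount`, `UCMix`, `UCMixDim`, `IsCLayerFamily`, `CLayerIneq`,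
`slice`, `BZP`, `GZeroRare`; the skeleton declares them in `Summit.PneNP.PneNP.Cruxes.UniversalCertAll.Coord`, here under the Theorems namespace
`…Theorems.ClusCoord` with the same short names and bodies) and the skeleton's sorry-free pieces: the base `ucMixDim_zero` and the induction on
the total dimension `ucMixDim_all` with the four stub statements as explicit hypotheses.

COORDINATE PEELING WITH MIXED BLOCK SIZES (p1's card): the space is `Fin M → ZMod 2`, a block map `blk : Fin M → Fin n` says which block each
coordinate belongs to, and `UCMix M n blk Y : Σ_{y∈Y} (dim_Y y − Σ_j (bsize j − 1)) ≤ Σ_j 2^{bsize j}·#{y ∈ Y : block j of y = 0}` (for constant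
block size `m` this is the crux: `stub_transfer`).  Induct on `M` by deleting ONE coordinate `i`: a coordinate layer family transfers the members'
certificates (`stub_cBook`); the two slices `{y_i = c}` lose at most one dimension per point (`stub_slice`, the FREE STEP whenever `W_i ≤ Z_{blk i}`);
block-zero-preserving linear automorphisms preserve the certificate (`stub_inv`); what remains is the conjecture `stub_cllZeroRare` on ZERO-RARE sets.

ROUTE-INDEPENDENT (no `Theses` import; the composition with the route decl is the registered skeleton's `UniversalCertAll_of_coord` = `stub_transfer`
applied to `ucMixDim_all …`).  HONEST FRAMING: objects + sorry-free bookkeeping for an OPEN crux of route ClusUniversalCertificate; the load-bearing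
stub `stub_cllZeroRare` is OPEN and XL; FRONTIER rung F-N1 — nothing here bears on P vs NP.
-/

set_option linter.dupNamespace false -- `Summit.PneNP.PneNP.…`: summit = sub-problem name (D-0017 single-conjunct layout)

namespace Summit.PneNP.PneNP.Theorems.ClusCoord

open Finset

/-- affine codimension inside `Y ⊆ 𝔽₂^M` of the largest flat through `y` contained in `Y` (mirror of `codimY`). -/
noncomputable def acodim (M : ℕ) (Y : Finset (Fin M → ZMod 2)) (y : Fin M → ZMod 2) : ℕ :=
  sInf {c : ℕ | ∃ A : AffineSubspace (ZMod 2) (Fin M → ZMod 2), y ∈ A ∧ (∀ z ∈ A, z ∈ Y) ∧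
    M ≤ Module.finrank (ZMod 2) A.direction + c}

/-- `D(Y) = Σ_{y∈Y} dim_Y(y)`. -/
noncomputable def dsum (M : ℕ) (Y : Finset (Fin M → ZMod 2)) : ℤ :=
  ∑ y ∈ Y, ((M : ℤ) - (acodim M Y y : ℤ))

/-- number of coordinates in block `j`. -/
def bsize {M n : ℕ} (blk : Fin M → Fin n) (j : Fin n) : ℕ := (univ.filter fun i => blk i = j).card

/-- `Z_j(Y)`: points whose block `j` vanishes. -/
noncomputable def zcount {M n : ℕ} (blk : Fin M → Fin n) (j : Fin n) (Y : Finset (Fin M → ZMod 2)) : ℕ :=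
  (Y.filter fun y => ∀ i, blk i = j → y i = 0).card

/-- `W_i(Y)`: points whose block `blk i` equals the unit vector `e_i`. -/
noncomputable def wcount {M n : ℕ} (blk : Fin M → Fin n) (i : Fin M) (Y : Finset (Fin M → ZMod 2)) : ℕ :=
  (Y.filter fun y => y i = 1 ∧ ∀ i', blk i' = blk i → i' ≠ i → y i' = 0).card

/-- the universal certificate with MIXED block sizes. -/
def UCMix (M n : ℕ) (blk : Fin M → Fin n) (Y : Finset (Fin M → ZMod 2)) : Prop :=
  ∑ y ∈ Y, (((M : ℤ) - (acodim M Y y : ℤ)) - ∑ j : Fin n, ((bsize blk j : ℤ) - 1)) ≤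
    ∑ j : Fin n, (2 : ℤ) ^ (bsize blk j) * (zcount blk j Y : ℤ)

/-- all block maps and all sets in total dimension `M`. -/
def UCMixDim (M : ℕ) : Prop := ∀ n : ℕ, ∀ blk : Fin M → Fin n, ∀ Y : Finset (Fin M → ZMod 2), UCMix M n blk Y

/-- `L` is a COORDINATE LAYER FAMILY for `(Y, i)`: each `x ∈ 𝔽₂^M` lies in as many members as `Y` has points over `x`
(0, 1 or 2) under deletion of coordinate `i`. -/
def IsCLayerFamily {M : ℕ} (Y : Finset (Fin (M + 1) → ZMod 2)) (i : Fin (M + 1))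
    (L : List (Finset (Fin M → ZMod 2))) : Prop :=
  ∀ x : Fin M → ZMod 2, (L.filter fun S => x ∈ S).length = (Y.filter fun y => Fin.removeNth i y = x).card

/-- the COORDINATE LAYER INEQUALITY `D(Y) ≤ Σ_{S∈L} D(S) + |Y| + 2^{bsize k − 1}(Z_k(Y) − W_i(Y))`, `k = blk i`. -/
def CLayerIneq (M n : ℕ) (blk : Fin (M + 1) → Fin n) (Y : Finset (Fin (M + 1) → ZMod 2)) (i : Fin (M + 1))
    (L : List (Finset (Fin M → ZMod 2))) : Prop :=
  dsum (M + 1) Y ≤ (L.map (dsum M)).sum + (Y.card : ℤ) +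
    (2 : ℤ) ^ (bsize blk (blk i) - 1) * ((zcount blk (blk i) Y : ℤ) - (wcount blk i Y : ℤ))

/-- the `c`-slice of `Y` along coordinate `i`, as a subset of `𝔽₂^M`. -/
noncomputable def slice {M : ℕ} (Y : Finset (Fin (M + 1) → ZMod 2)) (i : Fin (M + 1)) (c : ZMod 2) :
    Finset (Fin M → ZMod 2) :=
  (Y.filter fun y => y i = c).image (Fin.removeNth i)

/-- a linear automorphism PRESERVING BLOCK-ZERO PATTERNS (e.g. `GL` acting on one block): it preserves affine dimensions and
every `Z_j`, hence `UCMix` (`stub_inv`); it lets the deleted direction be ANY nonzero vector of a block, not just a unit vector. -/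
def BZP {M n : ℕ} (blk : Fin M → Fin n) (g : (Fin M → ZMod 2) ≃ₗ[ZMod 2] (Fin M → ZMod 2)) : Prop :=
  ∀ y : Fin M → ZMod 2, ∀ j : Fin n, (∀ i, blk i = j → g y i = 0) ↔ (∀ i, blk i = j → y i = 0)

/-- ZERO-RARE (up to block-zero-preserving automorphisms): no admissible change of coordinates makes some unit vector `e_i` at most
as frequent as `0` in its block — i.e. in every block `0` is STRICTLY the rarest value.  These are the only sets where the
induction step is not free. -/
def GZeroRare {M n : ℕ} (blk : Fin M → Fin n) (Y : Finset (Fin M → ZMod 2)) : Prop :=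
  ∀ g : (Fin M → ZMod 2) ≃ₗ[ZMod 2] (Fin M → ZMod 2), BZP blk g →
    ∀ i : Fin M, zcount blk (blk i) (Y.image fun y => g y) < wcount blk i (Y.image fun y => g y)

/-- base of the induction: total dimension 0. -/
theorem ucMixDim_zero : UCMixDim 0 := by
  intro n blk Y
  unfold UCMix
  have hb : ∀ j : Fin n, bsize blk j = 0 := by
    intro j; unfold bsize; simp
  have hz : ∀ j : Fin n, zcount blk j Y = Y.card := by
    intro j; unfold zcount
    congr 1
    apply Finset.filter_true_of_mem
    intro y _ i; exact Fin.elim0 i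
  have ha : ∀ y ∈ Y, acodim 0 Y y = 0 := by
    intro y hy
    unfold acodim
    apply Nat.eq_zero_of_le_zero
    apply Nat.sInf_le
    refine ⟨⊤, AffineSubspace.mem_top _ _ _, ?_, by simp⟩
    intro z _
    have : z = y := Subsingleton.elim z y
    rw [this]; exact hy
  have hl : ∑ y ∈ Y, ((((0 : ℕ) : ℤ) - (acodim 0 Y y : ℤ)) - ∑ j : Fin n, ((bsize blk j : ℤ) - 1)) =
      ∑ y ∈ Y, (n : ℤ) := by
    apply Finset.sum_congr rfl
    intro y hy
    rw [ha y hy]; simp [hb]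
  rw [hl]
  simp only [hb, hz, pow_zero, one_mul, Finset.sum_const, Finset.card_univ, Fintype.card_fin]
  rw [nsmul_eq_mul, nsmul_eq_mul, mul_comm]

/-- Strong form of the induction: every total dimension. -/
theorem ucMixDim_all (h₁ : ∀ M n blk Y i L, IsCLayerFamily Y i L → CLayerIneq M n blk Y i L →
      (∀ S ∈ L, UCMix M n (blk ∘ Fin.succAbove i) S) → UCMix (M + 1) n blk Y)
    (h₂ : ∀ M (Y : Finset (Fin (M + 1) → ZMod 2)) i, IsCLayerFamily Y i [slice Y i 0, slice Y i 1] ∧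
      dsum (M + 1) Y ≤ dsum M (slice Y i 0) + dsum M (slice Y i 1) + (Y.card : ℤ))
    (h₃ : ∀ M n blk (Y : Finset (Fin (M + 1) → ZMod 2)), GZeroRare blk Y →
      ∃ g : (Fin (M + 1) → ZMod 2) ≃ₗ[ZMod 2] (Fin (M + 1) → ZMod 2), BZP blk g ∧
        ∃ i L, IsCLayerFamily (Y.image fun y => g y) i L ∧ CLayerIneq M n blk (Y.image fun y => g y) i L)
    (h₄ : ∀ M n blk (Y : Finset (Fin M → ZMod 2)) (g : (Fin M → ZMod 2) ≃ₗ[ZMod 2] (Fin M → ZMod 2)),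
      BZP blk g → UCMix M n blk (Y.image fun y => g y) → UCMix M n blk Y) :
    ∀ M : ℕ, UCMixDim M := by
  intro M
  induction M with
  | zero => exact ucMixDim_zero
  | succ M ih =>
    intro n blk Y
    -- the free step on a set `Y'` with a coordinate `i` where `e_i` is at most as frequent as `0`
    have free : ∀ (Y' : Finset (Fin (M + 1) → ZMod 2)) (i : Fin (M + 1)),
        wcount blk i Y' ≤ zcount blk (blk i) Y' → UCMix (M + 1) n blk Y' := by
      intro Y' i hi
      obtain ⟨hfam, hloss⟩ := h₂ M Y' i
      refine h₁ M n blk Y' i [slice Y' i 0, slice Y' i 1] hfam ?_ (fun S _ => ih n (blk ∘ Fin.succAbove i) S)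
      unfold CLayerIneq
      have hzw : ((wcount blk i Y' : ℕ) : ℤ) ≤ ((zcount blk (blk i) Y' : ℕ) : ℤ) := by exact_mod_cast hi
      have hpow : (0 : ℤ) ≤ (2 : ℤ) ^ (bsize blk (blk i) - 1) := by positivity
      have hnn := mul_nonneg hpow (sub_nonneg.mpr hzw)
      simp only [List.map_cons, List.map_nil, List.sum_cons, List.sum_nil, add_zero]
      linarith
    by_cases hfree : ∃ g : (Fin (M + 1) → ZMod 2) ≃ₗ[ZMod 2] (Fin (M + 1) → ZMod 2), BZP blk g ∧
        ∃ i : Fin (M + 1), wcount blk i (Y.image fun y => g y) ≤ zcount blk (blk i) (Y.image fun y => g y)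
    · obtain ⟨g, hg, i, hi⟩ := hfree
      exact h₄ (M + 1) n blk Y g hg (free _ i hi)
    · have hzr : GZeroRare blk Y := by
        intro g hg i
        by_contra hlt
        exact hfree ⟨g, hg, i, not_lt.mp hlt⟩
      obtain ⟨g, hg, i, L, hfam, hineq⟩ := h₃ M n blk Y hzr
      exact h₄ (M + 1) n blk Y g hg (h₁ M n blk _ i L hfam hineq (fun S _ => ih n (blk ∘ Fin.succAbove i) S))

end Summit.PneNP.PneNP.Theorems.ClusCoord
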